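import Literature.Geometry.Lorentzian.CausalityClosedProofs
import Literature.Geometry.Lorentzian.CausalityPushUp
import Literature.Geometry.Lorentzian.IdealPoints
import Literature.Geometry.Lorentzian.CorrespondingBoundaryShadow
import HarnessLib

/-!
# An open set of a spacetime lies in its own chronological past

Stub `stub_isOpen_subset_chronologicalPast` of line `Sketch` of the crux
`LinearToNonlinearCapture` (stmt-FinalStateConjecture-14526): for a spacetime `𝓢` (connected
Hausdorff second-countable smooth Lorentzian `4`-manifold without boundary with a smooth time
orientation) and an open `U ⊆ 𝓢`, every `p ∈ U` is in the chronological past of some `q ∈ U`,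
i.e. `U ⊆ I⁻(U)`.

Proof (O'Neill 1983, Ch. 14, p. 402): the local integral curve `β` of the orienting timelike field
through `p` (`IntegralCurve.exists_isMIntegralCurveOn_Ioo`) is a future timelike curve; by
continuity of `β` at `0` there is a small `δ > 0` in its domain with `β δ ∈ U`, so
`β δ ∈ I⁺(p)` (`mem_chronologicalFuture_of_curve`), `p ∈ I⁻(β δ)`
(`mem_chronologicalPast_of_mem_chronologicalFuture`) and `I⁻(β δ) ⊆ I⁻(U)`
(`chronologicalPast_mono`).
-/

noncomputable section

open Bundle Set Filter Function
open scoped Manifold ContDiff Topology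

namespace Summit.FinalStateConjecture.FinalStateConjecture.Theorems

open Literature.Geometry.Lorentzian

set_option linter.dupNamespace false in
/-- **An open set of a spacetime lies in its own chronological past.** In a spacetime (connected
Hausdorff second-countable smooth Lorentzian `4`-manifold without boundary, smooth time
orientation) every open set `U` satisfies `U ⊆ I⁻(U)`: through `p ∈ U` passes the integral curve
of the orienting timelike field, a future timelike curve, whose points at small positive parameter
lie in `U` and are `≫ p`. O'Neill 1983, Ch. 14, p. 402. -/
theorem stub_isOpen_subset_chronologicalPast (𝓢 : Spacetime.{0} 4) {U : Set 𝓢.carrier}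
    (hU : IsOpen U) : U ⊆ 𝓢.metric.chronologicalPast 𝓢.timeOrientation U := by
  intro p hp
  -- the local integral curve `β` of the orienting field `T` through `p`
  have hX : ContMDiff (𝓡 4) (𝓡 4).tangent 1 (fun x ↦
      (⟨x, 𝓢.timeOrientation.vectorField x⟩ : TangentBundle (𝓡 4) 𝓢.carrier)) :=
    𝓢.timeOrientation.contMDiff.of_le (by exact_mod_cast le_top)
  obtain ⟨β, ε, hε, hβ0, hβ⟩ := IntegralCurve.exists_isMIntegralCurveOn_Ioo hX p 0
  -- a small positive parameter `δ` in the domain of `β` with `β δ ∈ U`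
  have h0 : Ioo (0 - ε) (0 + ε) ∈ 𝓝 (0 : ℝ) := Ioo_mem_nhds (by linarith) (by linarith)
  have hcont : ContinuousAt β 0 := (hβ.isMIntegralCurveAt h0).continuousAt
  have hpU : U ∈ 𝓝 (β 0) := hU.mem_nhds (hβ0 ▸ hp)
  have h1 : ∀ᶠ t in 𝓝 (0 : ℝ), β t ∈ U := hcont.preimage_mem_nhds hpU
  have h2 : ∀ᶠ t in 𝓝 (0 : ℝ), t < ε := Iio_mem_nhds hε
  have h3 : ∀ᶠ t in 𝓝[>] (0 : ℝ), 0 < t := eventually_mem_nhdsWithin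
  obtain ⟨δ, hδ0, hδU, hδε⟩ := (h3.and ((h1.and h2).filter_mono nhdsWithin_le_nhds)).exists
  -- the segment `β|[0, δ]` is a future timelike curve from `p` to `β δ ∈ U`
  have hseg : 𝓢.metric.IsFutureTimelikeCurveOn 𝓢.timeOrientation β (Icc 0 δ) := by
    intro t ht
    have hmem : Ioo (0 - ε) (0 + ε) ∈ 𝓝 t :=
      Ioo_mem_nhds (by linarith [ht.1]) (by linarith [ht.2])
    exact LorentzianMetric.futureTimelikeAt_of_hasMFDerivAt rfl
      (hβ.isMIntegralCurveAt hmem).hasMFDerivAt (𝓢.timeOrientation.isTimelike _)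
      (𝓢.timeOrientation.isFutureDirected_vectorField _)
  have hq : β δ ∈ 𝓢.metric.chronologicalFuture 𝓢.timeOrientation {β 0} :=
    LorentzianMetric.mem_chronologicalFuture_of_curve hseg le_rfl hδ0 le_rfl
  rw [hβ0] at hq
  exact LorentzianMetric.chronologicalPast_mono (singleton_subset_iff.mpr hδU)
    (LorentzianMetric.mem_chronologicalPast_of_mem_chronologicalFuture hq)

end Summit.FinalStateConjecture.FinalStateConjecture.Theorems

end
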